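import Summits.Ventures.HodgeRepro2.T5SU11KernelEnds
import Summits.Ventures.HodgeRepro2.T5SU11KernelResolventIdentity

/-!
# The decaying solution is decreasing in the spectral parameter: `χ_λ(s) ≤ χ_{λ₂}(s)` for `1 < λ₂ ≤ λ`

Row 5xx's monotonicity of the kernel in `λ` (`K_{λ₂}(t, s) ≤ K_λ(t, s)`, the kernel resolvent identity with a nonnegative composed
kernel) read at the origin `t → 0⁺`, where `K_λ(t, s) → −χ_λ(s)` (row 624):

* `sphDecay_anti_lam` — **`χ_λ(s) ≤ χ_{λ₂}(s)`** for `1 < λ₂ ≤ λ` and `s > 0`;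
* `sphDecay_antitoneOn_lam` — **`λ ↦ χ_λ(s)` is antitone on `(1, ∞)`**;
* `kernel_diagonal_anti_lam` — the diagonal `φ_λ(a_s) χ_λ(s)` is antitone in `λ` as well.

Nothing is claimed about (N).

Blind lane: Mathlib + the HodgeRepro2 prefix only; no sorry; axioms ⊆ {propext, Classical.choice,
Quot.sound}.
-/

namespace Summit.Ventures.HodgeRepro2.T5SU11SphericalDecayMonotoneLam

open Filter Topology MeasureTheory
open Set (Ioi)
open T5SU11Cartan T5SU11SphericalFunction T5SU11SphericalDecay T5SU11RadialGreenKernel T5SU11KernelEnds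
  T5SU11KernelResolventIdentity

section measure

variable [MeasurableSpace Circle] [BorelSpace Circle]

/-- **`χ_λ(s) ≤ χ_{λ₂}(s)`** for `1 < λ₂ ≤ λ` and `s > 0`: the decaying solution is decreasing in the spectral parameter. -/
theorem sphDecay_anti_lam {lam lam₂ : ℝ} (hlam : 1 < lam) (hlam₂ : 1 < lam₂) (hle : lam₂ ≤ lam) {s : ℝ} (hs : 0 < s) :
    sphDecay lam s ≤ sphDecay lam₂ s := by
  have h₁ := tendsto_kernel_nhdsGT_zero lam₂ hs
  have h₂ := tendsto_kernel_nhdsGT_zero lam hs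
  have hle' : -sphDecay lam₂ s ≤ -sphDecay lam s := by
    refine le_of_tendsto_of_tendsto h₁ h₂ ?_
    filter_upwards [self_mem_nhdsWithin] with t ht
    exact sphGreenKernel_mono hlam hlam₂ hle ht hs
  linarith

/-- **`λ ↦ χ_λ(s)` is antitone on `(1, ∞)`** for every `s > 0`. -/
theorem sphDecay_antitoneOn_lam {s : ℝ} (hs : 0 < s) : AntitoneOn (fun lam => sphDecay lam s) (Ioi 1) :=
  fun _ hlam₂ _ hlam hle => sphDecay_anti_lam hlam hlam₂ hle hs

/-- The diagonal `φ_λ(a_s) χ_λ(s)` is antitone in `λ` (`1 < λ₂ ≤ λ`). -/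
theorem kernel_diagonal_anti_lam {lam lam₂ : ℝ} (hlam : 1 < lam) (hlam₂ : 1 < lam₂) (hle : lam₂ ≤ lam) {s : ℝ}
    (hs : 0 < s) : sph lam (hyp s) * sphDecay lam s ≤ sph lam₂ (hyp s) * sphDecay lam₂ s := by
  have h := sphGreenKernel_mono hlam hlam₂ hle hs hs
  rw [kernel_eq_of_ge lam le_rfl, kernel_eq_of_ge lam₂ le_rfl] at h
  linarith

end measure

end Summit.Ventures.HodgeRepro2.T5SU11SphericalDecayMonotoneLam
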